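import Summits.KontsevichZagierPeriods.KontsevichZagierPeriods.Theorems.BetaCancellation.Negative.KernelForm
import Summits.KontsevichZagierPeriods.KontsevichZagierPeriods.Theorems.HurwitzMicroSectorsNormalFormPrincipleDimOneAssembly

/-!
# `BetaCancellation` (stmt-KontsevichZagierPeriods-13633) — the EVAL-SECTOR PRINCIPLE and the dimension `≤ 1` rational sector

Line `dirichlet-companion-to-pi`, registered stub `betaCancellation_of_dim_le_one_rational` (helper file,
`--supports` the crux; namespace `…BetaCancellationLine`).

The crux `BetaCancellation` (two-term pinned Beta cancellation, `q = β(a,b) ⊗ r`, `q' = β(a,b) ⊗ r'`,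
`q ∼ q' → r ∼ r'`) is equivalent to the open `π`-cancellation item stmt-0540
(`betaCancellation_iff_piCancellation`). Its VALUE SHADOW is unconditional: Fubini for pinned
representations (`BetaCancellationNegative.value_of_isPinned`) and `B(a,b) ≠ 0` give
`q ∼ q' → value r = value r'` (`value_eq_of_isPinned_of_equivalent`). Hence the
**eval-sector principle** (`kernelCancellation_of_valueRigid`): on every family of representations on
which Kontsevich–Zagier's Conjecture 1 is already a theorem ("equal values ⇒ equivalent"), cancellation
by ANY kernel of non-zero integral holds — for all exponents at once. The tree proves Conjecture 1 for
all representations of KZ's rational shape in dimension `≤ 1`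
(`HurwitzMicroSectors.NormalFormPrinciple.PiBox.Dlog.kzConjecture_of_dim_le_one`, Baker), whence the
registered stub `betaCancellation_of_dim_le_one_rational`: **`BetaCancellation` HOLDS for `r`, `r'` of
rational shape and dimensions `n, m ≤ 1`, for ALL positive rational `(a, b)`** (item 0540's own attack
suggestion (ii), "small cases: `c` supported in dimension `≤ 1`", in the crux's two-term form).
-/

noncomputable section

-- `Summit.KontsevichZagierPeriods.KontsevichZagierPeriods.…` is the tree's mandated layout (single-conjunct summit).
set_option linter.dupNamespace false

namespace Summit.KontsevichZagierPeriods.KontsevichZagierPeriods.BetaCancellationLine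

open MeasureTheory Set
open Literature.NumberTheory.Transcendental
open Literature.NumberTheory.Transcendental.KZ
open Summit.KontsevichZagierPeriods.KontsevichZagierPeriods.BetaCancellationNegative
open Summit.KontsevichZagierPeriods.HurwitzMicroSectors.NormalFormPrinciple.PiBox.Dlog
  (kzConjecture_of_dim_le_one)

/-- **EVAL-SECTOR PRINCIPLE.** Let `k` be a kernel on `(0,1)` with `∫₀¹ k ≠ 0`, and let `V n ⊆ IntegralRep n`
be a family of representations on which Conjecture 1 holds (`value r = value r' → r ∼ r'` for
`r ∈ V n`, `r' ∈ V m`). Then cancellation by `k` holds for bases in `V`: if `q`, `q'` are pinned over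
`r ∈ V n`, `r' ∈ V m` and `q ∼ q'`, then `r ∼ r'` (soundness + Fubini: `(∫k)·value r = (∫k)·value r'`).
[folklore] -/
theorem kernelCancellation_of_valueRigid {k : ℝ → ℝ} (hk : ∫ t in Ioo (0:ℝ) 1, k t ≠ 0)
    (V : ∀ n : ℕ, Set (IntegralRep n))
    (hV : ∀ ⦃n m : ℕ⦄ (r : IntegralRep n) (r' : IntegralRep m), r ∈ V n → r' ∈ V m →
      r.value = r'.value → Equivalent r r')
    ⦃n m : ℕ⦄ {r : IntegralRep n} {r' : IntegralRep m} (hr : r ∈ V n) (hr' : r' ∈ V m)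
    {q : IntegralRep (1 + n)} {q' : IntegralRep (1 + m)} (hq : IsPinned k r q) (hq' : IsPinned k r' q')
    (hqq' : Equivalent q q') : Equivalent r r' :=
  hV r r' hr hr' (value_eq_of_isPinned_of_equivalent hk hq hq' hqq')

/-- **Rigidity saturates**: if Conjecture 1 holds on the family `V`, it holds on the family of all
representations EQUIVALENT to a member of `V` (values are move-invariant, `Equivalent.value_eq_holds`).
So every eval-sector extends to its saturation under the moves (e.g. the dimension-`≤ 1` rational
sector below covers every representation equivalent to a rational one of dimension `≤ 1`). [folklore] -/
theorem valueRigid_saturate (V : ∀ n : ℕ, Set (IntegralRep n))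
    (hV : ∀ ⦃n m : ℕ⦄ (r : IntegralRep n) (r' : IntegralRep m), r ∈ V n → r' ∈ V m →
      r.value = r'.value → Equivalent r r') :
    ∀ ⦃n m : ℕ⦄ (r : IntegralRep n) (r' : IntegralRep m),
      r ∈ {r : IntegralRep n | ∃ (l : ℕ) (r₀ : IntegralRep l), r₀ ∈ V l ∧ Equivalent r r₀} →
      r' ∈ {r' : IntegralRep m | ∃ (l : ℕ) (r₀ : IntegralRep l), r₀ ∈ V l ∧ Equivalent r' r₀} →
      r.value = r'.value → Equivalent r r' := by
  rintro n m r r' ⟨l, r₀, hr₀, hrr₀⟩ ⟨l', r₀', hr₀', hrr₀'⟩ hv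
  have hv₀ : r₀.value = r₀'.value := by
    rw [← Equivalent.value_eq_holds hrr₀, ← Equivalent.value_eq_holds hrr₀', hv]
  exact (hrr₀.trans (hV r₀ r₀' hr₀ hr₀' hv₀)).trans hrr₀'.symm

/-- **The saturated dimension-`≤ 1` sector**: cancellation by any kernel of non-zero integral holds
whenever `r` and `r'` are each EQUIVALENT to some representation of KZ's rational shape in dimension
`≤ 1` (eval-sector principle + saturation + `kzConjecture_of_dim_le_one`). [folklore] -/
theorem kernelCancellation_of_equivalent_dim_le_one {k : ℝ → ℝ} (hk : ∫ t in Ioo (0:ℝ) 1, k t ≠ 0)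
    ⦃n m : ℕ⦄ {r : IntegralRep n} {r' : IntegralRep m}
    (hr : ∃ (l : ℕ) (r₀ : IntegralRep l), (l ≤ 1 ∧ r₀.IsRational) ∧ Equivalent r r₀)
    (hr' : ∃ (l : ℕ) (r₀ : IntegralRep l), (l ≤ 1 ∧ r₀.IsRational) ∧ Equivalent r' r₀)
    {q : IntegralRep (1 + n)} {q' : IntegralRep (1 + m)} (hq : IsPinned k r q) (hq' : IsPinned k r' q')
    (hqq' : Equivalent q q') : Equivalent r r' :=
  kernelCancellation_of_valueRigid hk
    (fun n => {r : IntegralRep n | ∃ (l : ℕ) (r₀ : IntegralRep l),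
      r₀ ∈ (fun l => {r₀ : IntegralRep l | l ≤ 1 ∧ r₀.IsRational}) l ∧ Equivalent r r₀})
    (valueRigid_saturate (fun l => {r₀ : IntegralRep l | l ≤ 1 ∧ r₀.IsRational})
      (fun _ _ r₀ r₀' hr₀ hr₀' hv => kzConjecture_of_dim_le_one hr₀.1 hr₀'.1 r₀ r₀' hr₀.2 hr₀'.2 hv))
    hr hr' hq hq' hqq'

/-- **STUB `betaCancellation_of_dim_le_one_rational`** (registered on the crux item): `BetaCancellation`
HOLDS, for ALL positive rational exponents `(a, b)`, whenever `r`, `r'` have KZ's rational shape and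
dimensions `≤ 1` — the eval-sector principle over `kzConjecture_of_dim_le_one` (Baker). [folklore] -/
theorem betaCancellation_of_dim_le_one_rational :
    ∀ (a b : ℚ), 0 < a → 0 < b → ∀ ⦃n m : ℕ⦄, n ≤ 1 → m ≤ 1 → ∀ (r : IntegralRep n) (r' : IntegralRep m),
    r.IsRational → r'.IsRational → ∀ (q : IntegralRep (1 + n)) (q' : IntegralRep (1 + m)),
    q.domain = {z | z (Fin.castAdd n 0) ∈ Set.Ioo (0:ℝ) 1 ∧ (fun j => z (Fin.natAdd 1 j)) ∈ r.domain} →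
    Set.EqOn q.integrand (fun z => (z (Fin.castAdd n 0)) ^ ((a:ℝ) - 1) * (1 - z (Fin.castAdd n 0)) ^ ((b:ℝ) - 1) *
      r.integrand (fun j => z (Fin.natAdd 1 j))) q.domain →
    q'.domain = {z | z (Fin.castAdd m 0) ∈ Set.Ioo (0:ℝ) 1 ∧ (fun j => z (Fin.natAdd 1 j)) ∈ r'.domain} →
    Set.EqOn q'.integrand (fun z => (z (Fin.castAdd m 0)) ^ ((a:ℝ) - 1) * (1 - z (Fin.castAdd m 0)) ^ ((b:ℝ) - 1) *
      r'.integrand (fun j => z (Fin.natAdd 1 j))) q'.domain →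
    Equivalent q q' → Equivalent r r' := by
  intro a b ha hb n m hn hm r r' hr hr' q q' hd hi hd' hi' hqq'
  exact kernelCancellation_of_valueRigid (k := betaKernel a b) (integral_betaKernel_pos ha hb).ne'
    (fun n => {r : IntegralRep n | n ≤ 1 ∧ r.IsRational})
    (fun n m r r' hr hr' hv => kzConjecture_of_dim_le_one hr.1 hr'.1 r r' hr.2 hr'.2 hv)
    ⟨hn, hr⟩ ⟨hm, hr'⟩ ⟨hd, hi⟩ ⟨hd', hi'⟩ hqq'

end Summit.KontsevichZagierPeriods.KontsevichZagierPeriods.BetaCancellationLine
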